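import Summits.QuantumFields.YangMills.Theorems.LuscherReductionTwistedTraceScalingBTFibreProfile
import Summits.QuantumFields.YangMills.Theorems.LuscherReductionTwistedTraceScalingBTColourFP
import Summits.QuantumFields.YangMills.Theorems.LuscherReductionTwistedTraceScalingOrthoTransverseRotation
import HarnessLib

/-!
# THE FROZEN PROFILE OF RECORD for «ratepack-v3»: the indicator of the fibre core `{x = v̂ : v ∈ capBalancedSet, ‖x‖ ≤ (√β)⁻¹}` (β ≥ 4) — it meets every profile hypothesis of
# `profileDressing_package` (measurable, `0 ≤ Ω₀ ≤ 1`, colour-blind, core-supported in both forms, `∫Ω₀ dπ > 0` and `recordGamma > 0` eventually) and vanishes for `β < 4`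
# (route `FlatTubeReduction`, crux K1 `NearFlatRatioLaw` stmt-QuantumFields-24720; seat `ym-line-ftr-p1` g14; rate twin «ratepack-v3 / frozen fibres»; R2b1 RECORD rung — no summit
# statement is proved here)

WHY (memo `Cruxes/NearFlatRatioLaw/Lines/ratepack-v3-frozen-g12.md` §8.2).  The profile/N/W package of the rate twin (`…ProfileDressingPackage`) is stated for ANY colour-blind frozen family
`0 ≤ Ω₀_β ≤ 1` supported in the fibre core `{v ∈ cap-balanced, ‖v̂‖ ≤ (√β)⁻¹, |v_{e,c}| ≤ (√β)⁻¹}` (and `‖x‖ ≤ (√β)⁻¹`) with `∫Ω₀_β dπ > 0`, `recordGamma Ω₀ β > 0` eventually; the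
`AnalyticRatePotInput` fields `hr : 0 ≤ r β ≤ ½`, `hΩr` want in addition `Ω₀_β = 0` whenever `(√β)⁻¹ > ½`.  This file exhibits such a family (the "profile choice" item of the Census):
the indicator of the core, read on `LinkSpace L` through the coordinates `x ↦ (e,a) ↦ x(e,a)`; colour-blindness from `linkEmbed (Ad_c v) = adL c (linkEmbed v)` and the invariance of the
cap-balanced set and of the norm; positivity from `orthoTransverse_ball_pos` and `π((cap-balanced)ᶜ) = 0`.
  ★★ `exists_ratepackProfile`.
HONEST FRAMING: an explicit choice, no analysis; femto rung R2b1 (RECORD label); not infinite volume, not a gap, not Clay.  No defs (the family is produced existentially), no named facts,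
no `sorry`.
-/

set_option autoImplicit false

noncomputable section

open MeasureTheory Filter Topology Real
open scoped BigOperators
open Literature.MathematicalPhysics.QuantumFieldTheory
open Literature.MathematicalPhysics.QuantumLattice

namespace Summit.QuantumFields.YangMills.Theorems.FemtoTransferGap.TwoLattice.ConstTube

open Summit.QuantumFields.YangMills.Theorems.FemtoTransferGap
open Summit.QuantumFields.YangMills.Theorems.FemtoTransferGap.TwoLattice.Avg
open Summit.QuantumFields.YangMills.Theorems.FemtoTransferGap.TwoLattice.Stiff (LinkSpace)

variable {L : ℕ} [NeZero L]

omit [NeZero L] in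
/-- Reading a link-space vector back as a family of colour vectors inverts `linkEmbed`. [folklore] -/
theorem unembed_linkEmbed (v : Edge 3 L → Fin 3 → ℝ) : (fun (e : Edge 3 L) (a : Fin 3) => linkEmbed L v (e, a)) = v := by
  funext e a; rw [linkEmbed_apply]

omit [NeZero L] in
/-- `linkEmbed` of the read-back family is the vector. [folklore] -/
theorem linkEmbed_unembed (x : LinkSpace L) : linkEmbed L (fun (e : Edge 3 L) (a : Fin 3) => x (e, a)) = x := by
  ext ea; rw [linkEmbed_apply]

/-- The read-back of `adL c x` is the colour rotation of the read-back of `x`. [folklore] -/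
theorem unembed_adL (c : SU2) (x : LinkSpace L) :
    (fun (e : Edge 3 L) (a : Fin 3) => adL L c x (e, a)) = colourRotate L (fun _ => c) (fun (e : Edge 3 L) (a : Fin 3) => x (e, a)) := by
  have h := linkEmbed_colourRotate_const (L := L) c (fun (e : Edge 3 L) (a : Fin 3) => x (e, a))
  rw [linkEmbed_unembed] at h
  rw [← h, unembed_linkEmbed]

omit [NeZero L] in
/-- The read-back map is continuous. [folklore] -/
theorem continuous_unembed : Continuous fun (x : LinkSpace L) => fun (e : Edge 3 L) (a : Fin 3) => x (e, a) := by
  refine continuous_pi fun e => continuous_pi fun a => ?_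
  exact (EuclideanSpace.proj (e, a) : LinkSpace L →L[ℝ] ℝ).continuous

/-- ★★ **THE PROFILE OF RECORD.**  There is a family `Ω₀ : ℝ → LinkSpace L → ℝ` with: `Ω₀ β` measurable; `0 ≤ Ω₀ ≤ 1`; colour-blind; `Ω₀ β (v̂) ≠ 0 ⇒ v ∈ capBalancedSet ∧ ‖v̂‖ ≤ (√β)⁻¹ ∧
|v_{e,c}| ≤ (√β)⁻¹`; `Ω₀ β x ≠ 0 ⇒ ‖x‖ ≤ (√β)⁻¹`; `Ω₀ β = 0` for `β < 4`; and eventually `0 < ∫ Ω₀ β (v̂) dπ(v)` and `0 < recordGamma L Ω₀ β`. [folklore] -/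
theorem exists_ratepackProfile :
    ∃ Ω₀ : ℝ → LinkSpace L → ℝ, (∀ β, Measurable (Ω₀ β)) ∧ (∀ β x, 0 ≤ Ω₀ β x) ∧ (∀ β x, Ω₀ β x ≤ 1) ∧
      (∀ β (g : SU2) (x : LinkSpace L), Ω₀ β (adL L g x) = Ω₀ β x) ∧
      (∀ β (v : Edge 3 L → Fin 3 → ℝ), Ω₀ β (linkEmbed L v) ≠ 0 →
        v ∈ capBalancedSet L ∧ ‖linkEmbed L v‖ ≤ (Real.sqrt β)⁻¹ ∧ ∀ (e : Edge 3 L) (c : Fin 3), |v e c| ≤ (Real.sqrt β)⁻¹) ∧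
      (∀ β x, Ω₀ β x ≠ 0 → ‖x‖ ≤ (Real.sqrt β)⁻¹) ∧ (∀ β, β < 4 → ∀ x, Ω₀ β x = 0) ∧
      (∀ᶠ β : ℝ in atTop, 0 < ∫ v, Ω₀ β (linkEmbed L v) ∂orthoTransverse L) ∧ (∀ᶠ β : ℝ in atTop, 0 < recordGamma L Ω₀ β) := by
  classical
  haveI := isFiniteMeasure_orthoTransverse L
  -- the core, read on `LinkSpace L`
  obtain ⟨S, hSdef⟩ : ∃ S : ℝ → Set (LinkSpace L), S = fun β => {x | (4 : ℝ) ≤ β ∧ (fun (e : Edge 3 L) (a : Fin 3) => x (e, a)) ∈ capBalancedSet L ∧ ‖x‖ ≤ (Real.sqrt β)⁻¹} :=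
    ⟨_, rfl⟩
  have hSm : ∀ β, MeasurableSet (S β) := fun β => by
    rw [hSdef]
    refine (measurableSet_setOf.mpr measurable_const).inter (MeasurableSet.inter ?_ ?_)
    · exact (isClosed_capBalancedSet L).measurableSet.preimage continuous_unembed.measurable
    · exact measurableSet_le continuous_norm.measurable measurable_const
  obtain ⟨Ω₀, hΩdef⟩ : ∃ Ω₀ : ℝ → LinkSpace L → ℝ, Ω₀ = fun β => (S β).indicator fun _ => (1 : ℝ) := ⟨_, rfl⟩
  have hΩapp : ∀ β x, Ω₀ β x = if x ∈ S β then 1 else 0 := fun β x => by rw [hΩdef]; exact Set.indicator_apply (S β) (fun _ => (1 : ℝ)) x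
  have hmemS : ∀ β x, x ∈ S β ↔ (4 : ℝ) ≤ β ∧ (fun (e : Edge 3 L) (a : Fin 3) => x (e, a)) ∈ capBalancedSet L ∧ ‖x‖ ≤ (Real.sqrt β)⁻¹ := fun β x => by
    rw [hSdef]; rfl
  have hne : ∀ β x, Ω₀ β x ≠ 0 → x ∈ S β := fun β x h => by
    by_contra hx; rw [hΩapp, if_neg hx] at h; exact h rfl
  -- the preimage of the core under `linkEmbed`
  have hpre : ∀ β (v : Edge 3 L → Fin 3 → ℝ), linkEmbed L v ∈ S β ↔ (4 : ℝ) ≤ β ∧ v ∈ capBalancedSet L ∧ ‖linkEmbed L v‖ ≤ (Real.sqrt β)⁻¹ := fun β v => by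
    rw [hmemS, unembed_linkEmbed]
  refine ⟨Ω₀, fun β => ?_, fun β x => ?_, fun β x => ?_, fun β g x => ?_, fun β v h => ?_, fun β x h => ?_, fun β hβ x => ?_, ?_, ?_⟩
  · rw [hΩdef]; exact measurable_const.indicator (hSm β)
  · rw [hΩapp]; split_ifs <;> norm_num
  · rw [hΩapp]; split_ifs <;> norm_num
  · -- colour-blind
    rw [hΩapp, hΩapp]
    have hiff : adL L g x ∈ S β ↔ x ∈ S β := by
      rw [hmemS, hmemS, unembed_adL, adL_apply, norm_adLin]
      constructor
      · rintro ⟨h4, hc, hn⟩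
        refine ⟨h4, ?_, hn⟩
        have h := colourRotate_mem_capBalancedSet L (r := fun _ => g⁻¹) hc
        rwa [colourRotate_mul, show ((fun _ : Fin 3 => g⁻¹) * fun _ : Fin 3 => g) = 1 from funext fun _ => inv_mul_cancel g, colourRotate_one] at h
      · rintro ⟨h4, hc, hn⟩
        exact ⟨h4, colourRotate_mem_capBalancedSet L hc, hn⟩
    simp only [hiff]
  · -- support, `v̂` form
    obtain ⟨-, hc, hn⟩ := (hpre β v).mp (hne β _ h)
    refine ⟨hc, hn, fun e c => ?_⟩
    calc |v e c| = ‖v e c‖ := (Real.norm_eq_abs _).symm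
      _ ≤ ‖v e‖ := norm_le_pi_norm (v e) c
      _ ≤ ‖linkEmbed L v‖ := norm_apply_le_norm_linkEmbed v e
      _ ≤ (Real.sqrt β)⁻¹ := hn
  · exact ((hmemS β x).mp (hne β x h)).2.2
  · rw [hΩapp, if_neg]
    rw [hmemS]; rintro ⟨h4, -, -⟩; linarith
  · -- `∫ Ω₀ β (v̂) dπ > 0` for `β ≥ 4`
    filter_upwards [Filter.eventually_ge_atTop (4 : ℝ)] with β hβ
    have hρ : 0 < (Real.sqrt β)⁻¹ := inv_pos.mpr (Real.sqrt_pos.mpr (by linarith))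
    have hTm : MeasurableSet (linkEmbed L ⁻¹' S β) := (hSm β).preimage (measurable_linkEmbed L)
    have hind : (fun v => Ω₀ β (linkEmbed L v)) = (linkEmbed L ⁻¹' S β).indicator fun _ => (1 : ℝ) := by
      funext v; rw [hΩapp, Set.indicator_apply, Set.mem_preimage]
    have hI := integral_indicator_const (μ := orthoTransverse L) (1 : ℝ) hTm
    rw [← hind] at hI
    simp only [smul_eq_mul, mul_one] at hI
    rw [hI]
    -- `π(ball) ≤ π(preimage) + π(capᶜ) = π(preimage)`
    have hball := orthoTransverse_ball_pos L hρ
    have hsub : {v : Edge 3 L → Fin 3 → ℝ | ‖linkEmbed L v‖ < (Real.sqrt β)⁻¹} ⊆ linkEmbed L ⁻¹' S β ∪ (capBalancedSet L)ᶜ := by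
      intro v hv
      by_cases hc : v ∈ capBalancedSet L
      · exact Or.inl ((hpre β v).mpr ⟨hβ, hc, le_of_lt hv⟩)
      · exact Or.inr hc
    have hle : orthoTransverse L {v | ‖linkEmbed L v‖ < (Real.sqrt β)⁻¹} ≤ orthoTransverse L (linkEmbed L ⁻¹' S β) := by
      calc orthoTransverse L {v | ‖linkEmbed L v‖ < (Real.sqrt β)⁻¹} ≤ orthoTransverse L (linkEmbed L ⁻¹' S β ∪ (capBalancedSet L)ᶜ) := measure_mono hsub
        _ ≤ orthoTransverse L (linkEmbed L ⁻¹' S β) + orthoTransverse L (capBalancedSet L)ᶜ := measure_union_le _ _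
        _ = orthoTransverse L (linkEmbed L ⁻¹' S β) := by rw [orthoTransverse_compl_capBalancedSet L, add_zero]
    have hpos : 0 < orthoTransverse L (linkEmbed L ⁻¹' S β) := lt_of_lt_of_le hball hle
    simp only [measureReal_def]
    exact ENNReal.toReal_pos hpos.ne' (measure_ne_top _ _)
  · -- `recordGamma > 0` for `β ≥ 4`
    filter_upwards [Filter.eventually_ge_atTop (4 : ℝ)] with β hβ
    have hρ : 0 < (Real.sqrt β)⁻¹ := inv_pos.mpr (Real.sqrt_pos.mpr (by linarith))
    unfold recordGamma boGamma
    refine mul_pos (fpWeightBar_pos L (powScale_pos 1 β)) ?_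
    set s : ℝ := powScale 1 β with hs
    set f : (Edge 3 L → Fin 3 → ℝ) → ℝ := fun v => Ω₀ β (linkEmbed L v) ^ 2 * Real.exp (‖(gaugeModes L).starProjection (linkEmbed L v)‖ ^ 2 / s ^ 2) with hf
    have hΩm : Measurable (Ω₀ β) := by rw [hΩdef]; exact measurable_const.indicator (hSm β)
    have hfm : Measurable f := by
      rw [hf]
      exact ((hΩm.comp (measurable_linkEmbed L)).pow_const 2).mul
        (Real.measurable_exp.comp ((((gaugeModes L).starProjection.continuous.measurable.comp (measurable_linkEmbed L)).norm.pow_const 2).div_const _))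
    have hf0 : ∀ v, 0 ≤ f v := fun v => mul_nonneg (sq_nonneg _) (Real.exp_pos _).le
    have hΩ1 : ∀ x, |Ω₀ β x| ≤ 1 := fun x => by rw [hΩapp]; split_ifs <;> norm_num
    have hfb : ∀ v, |f v| ≤ 1 ^ 2 * Real.exp ((Real.sqrt β)⁻¹ ^ 2 / s ^ 2) := fun v => by
      rw [abs_of_nonneg (hf0 v), hf]; dsimp only
      by_cases hz : Ω₀ β (linkEmbed L v) = 0
      · rw [hz]; simp only [ne_eq, OfNat.ofNat_ne_zero, not_false_eq_true, zero_pow, zero_mul]; positivity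
      · have hx : ‖linkEmbed L v‖ ≤ (Real.sqrt β)⁻¹ := ((hmemS β _).mp (hne β _ hz)).2.2
        have h1 : Ω₀ β (linkEmbed L v) ^ 2 ≤ 1 ^ 2 := by rw [← sq_abs]; exact pow_le_pow_left₀ (abs_nonneg _) (hΩ1 _) 2
        have h2 : ‖(gaugeModes L).starProjection (linkEmbed L v)‖ ^ 2 / s ^ 2 ≤ (Real.sqrt β)⁻¹ ^ 2 / s ^ 2 := by
          have hP : ‖(gaugeModes L).starProjection (linkEmbed L v)‖ ≤ ‖linkEmbed L v‖ := Submodule.norm_starProjection_apply_le _ _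
          exact div_le_div_of_nonneg_right (pow_le_pow_left₀ (norm_nonneg _) (hP.trans hx) 2) (sq_nonneg _)
        exact mul_le_mul h1 (Real.exp_le_exp.mpr h2) (Real.exp_pos _).le (by positivity)
    have hint : Integrable f (orthoTransverse L) := integrable_of_measurable_abs_le _ hfm hfb
    rw [integral_pos_iff_support_of_nonneg hf0 hint]
    have hsub : {v : Edge 3 L → Fin 3 → ℝ | ‖linkEmbed L v‖ < (Real.sqrt β)⁻¹} ⊆ Function.support f ∪ (capBalancedSet L)ᶜ := by
      intro v hv
      by_cases hc : v ∈ capBalancedSet L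
      · refine Or.inl ?_
        have hmem : linkEmbed L v ∈ S β := (hpre β v).mpr ⟨hβ, hc, le_of_lt hv⟩
        have h1 : Ω₀ β (linkEmbed L v) = 1 := by rw [hΩapp, if_pos hmem]
        rw [Function.mem_support, hf]; dsimp only
        rw [h1]; positivity
      · exact Or.inr hc
    calc 0 < orthoTransverse L {v | ‖linkEmbed L v‖ < (Real.sqrt β)⁻¹} := orthoTransverse_ball_pos L hρ
      _ ≤ orthoTransverse L (Function.support f ∪ (capBalancedSet L)ᶜ) := measure_mono hsub
      _ ≤ orthoTransverse L (Function.support f) + orthoTransverse L (capBalancedSet L)ᶜ := measure_union_le _ _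
      _ = orthoTransverse L (Function.support f) := by rw [orthoTransverse_compl_capBalancedSet L, add_zero]

end Summit.QuantumFields.YangMills.Theorems.FemtoTransferGap.TwoLattice.ConstTube

end
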